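import Summits.KontsevichZagierPeriods.KontsevichZagierPeriods.Theses.DefinableMoves
import Literature.NumberTheory.Transcendental.KZKernelConjectureForms

/-!
# Crux `Transfer` (stmt-KontsevichZagierPeriods-4088) — placement relative to the summit (strategist r1)

Kernel-checked facts used by `Cruxes/Transfer/STRATEGY-CENSUS.md`:

* `transfer_iff_bc` — the crux in bundled form: `Transfer ↔ ∀ c, bc c ∈ KZOver.relations ℝ → c ∈ KZ.relations`
  (`bc = KZOver.baseChange ℚ ℝ ∘ KZOver.equivKZ`; the inline `let`-calculus of the route file is `KZOver.Raw.Rel`).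
* `transfer_of_summit : KontsevichZagierPeriods → Transfer` — the crux is a CONSEQUENCE of the summit
  (S→C direction PROVED): a real certificate forces `KZ.eval c = 0` (soundness of `KZ_ℝ`), and the summit in
  kernel form (`kzKernelConjecture_iff_isRational`) puts `c` into `KZ.relations`.
* `summit_iff_transfer_and_realKZ : KontsevichZagierPeriods ↔ Transfer ∧ RealKZ` — the route's `closes` is an
  honest CONJUNCT SPLIT of the summit: `Transfer` is the theorem-grade conjunct, `RealKZ` the residual.
* `realKZ_iff_summit_of_transfer : Transfer → (RealKZ ↔ KontsevichZagierPeriods)`.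

No theorem of shape `Transfer → KontsevichZagierPeriods` is claimed or known (C→S probes fail, file `Transfer_probe.lean`).
-/

noncomputable section

open Literature.NumberTheory.Transcendental
open Summit.KontsevichZagierPeriods.KontsevichZagierPeriods.Theses
open Summit.KontsevichZagierPeriods.KontsevichZagierPeriods.Theses.DefinableMoves

namespace Summit.KontsevichZagierPeriods.KontsevichZagierPeriods.Cruxes.Transfer.Placement

/-- The real base change of formal combinations, bundled. [folklore] -/
def bc : KZ.FormalRep →+ KZOver.FormalRep ℝ :=
  (KZOver.baseChange ℚ ℝ).comp KZOver.equivKZ.toAddMonoidHom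

@[simp] theorem bc_apply (c : KZ.FormalRep) :
    bc c = KZOver.baseChange ℚ ℝ (KZOver.equivKZ c) := rfl

theorem bc_of {n : ℕ} (r : KZ.IntegralRep n) :
    bc (KZ.of r) = KZOver.of (KZOver.IntegralRep.ofKZOver ℝ r) := rfl

/-- `ℚ`-relations are `ℝ`-relations after base change (the easy inclusion `≥` of the crux). [folklore] -/
theorem bc_mem_relations {c : KZ.FormalRep} (hc : c ∈ KZ.relations) :
    bc c ∈ KZOver.relations ℝ :=
  KZOver.baseChange_mem_relations ℝ ((KZOver.equivKZ_mem_relations_iff c).mpr hc)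

/-- Base change commutes with evaluation. [folklore] -/
theorem eval_bc (c : KZ.FormalRep) : KZOver.eval ℝ (bc c) = KZ.eval c := by
  simp [bc]

/-- `toRaw ∘ bc` is the route's `incl`. [folklore] -/
theorem toRaw_comp_bc :
    KZOver.toRaw.comp bc =
      FreeAbelianGroup.map (fun x : (Σ n, KZ.IntegralRep n) => (⟨x.1, (x.2.domain, x.2.integrand)⟩ :
        Σ n : ℕ, Set (Fin n → ℝ) × ((Fin n → ℝ) → ℝ))) := by
  refine FreeAbelianGroup.lift_ext _ _ fun ⟨n, r⟩ => ?_
  simp only [AddMonoidHom.coe_comp, Function.comp_apply]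
  change KZOver.toRaw (bc (KZ.of r)) = _
  rw [bc_of, KZOver.toRaw_of]
  rfl

theorem toRaw_bc (c : KZ.FormalRep) :
    KZOver.toRaw (bc c) =
      FreeAbelianGroup.map (fun x : (Σ n, KZ.IntegralRep n) => (⟨x.1, (x.2.domain, x.2.integrand)⟩ :
        Σ n : ℕ, Set (Fin n → ℝ) × ((Fin n → ℝ) → ℝ))) c :=
  DFunLike.congr_fun toRaw_comp_bc c

theorem bc_mem_relations_iff_raw (c : KZ.FormalRep) :
    bc c ∈ KZOver.relations ℝ ↔
      FreeAbelianGroup.map (fun x : (Σ n, KZ.IntegralRep n) => (⟨x.1, (x.2.domain, x.2.integrand)⟩ :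
        Σ n : ℕ, Set (Fin n → ℝ) × ((Fin n → ℝ) → ℝ))) c ∈ KZOver.Raw.Rel := by
  rw [KZOver.mem_relations_iff_toRaw_mem, toRaw_bc]

/-- **The crux in bundled form**: `Transfer ↔ (Rel_ℝ.comap bc ≤ KZ.relations)`. [folklore] -/
theorem transfer_iff_bc :
    DefinableMoves.Transfer ↔ ∀ c : KZ.FormalRep, bc c ∈ KZOver.relations ℝ → c ∈ KZ.relations := by
  constructor
  · intro hT c hc
    rw [bc_mem_relations_iff_raw] at hc
    exact hT c hc
  · intro h
    unfold DefinableMoves.Transfer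
    intro Adm o Rel incl c hc
    apply h c
    rw [bc_mem_relations_iff_raw]
    exact hc

/-- A real certificate forces the value to vanish (soundness of `KZ_ℝ`). [folklore] -/
theorem eval_eq_zero_of_bc_mem {c : KZ.FormalRep} (hc : bc c ∈ KZOver.relations ℝ) : KZ.eval c = 0 := by
  have h := KZOver.eval_eq_zero_of_mem_relations hc
  rwa [eval_bc] at h

/-- **S → C: the crux is a consequence of the summit.** [folklore] -/
theorem transfer_of_summit (h : _root_.KontsevichZagierPeriods) : DefinableMoves.Transfer := by
  rw [transfer_iff_bc]
  intro c hc
  exact (kzKernelConjecture_iff_isRational.mpr h) c (eval_eq_zero_of_bc_mem hc)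

/-- The summit in kernel form ⇒ `RealKZ` (copy of `Cruxes/RealKZ/PiSplit.realKZ_of_summit`, inlined). [folklore] -/
theorem realKZ_of_summit (h : _root_.KontsevichZagierPeriods) : DefinableMoves.RealKZ := by
  unfold DefinableMoves.RealKZ
  intro Adm o Rel incl n m r r' _ _ hv
  rw [map_sub]
  change KZOver.Raw.gen n r.domain r.integrand - KZOver.Raw.gen m r'.domain r'.integrand ∈
    KZOver.Raw.Rel
  rw [KZOver.Raw.gen_sub_gen_mem_Rel_iff_kz, KZOver.Equivalent]
  have hk : KZ.of r - KZ.of r' ∈ KZ.relations :=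
    (kzKernelConjecture_iff_isRational.mpr h) (KZ.of r - KZ.of r') (by rw [KZ.eval_of_sub_of, hv, sub_self])
  have hb := bc_mem_relations hk
  rw [map_sub, bc_of, bc_of] at hb
  exact hb

/-- `Transfer ∧ RealKZ → S` — the term of the route's `closes` without its idle first binder
`IntegrabilityLocus` (which `closes` does not consume). [folklore] -/
theorem summit_of_transfer_of_realKZ (hT : DefinableMoves.Transfer) (hR : DefinableMoves.RealKZ) :
    _root_.KontsevichZagierPeriods :=
  fun _ _ r r' hr hr' hv => hT _ (hR r r' hr hr' hv)

/-- **S ↔ Transfer ∧ RealKZ**: the route is an honest conjunct split of the summit. [folklore] -/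
theorem summit_iff_transfer_and_realKZ :
    _root_.KontsevichZagierPeriods ↔ DefinableMoves.Transfer ∧ DefinableMoves.RealKZ :=
  ⟨fun h => ⟨transfer_of_summit h, realKZ_of_summit h⟩, fun h => summit_of_transfer_of_realKZ h.1 h.2⟩

/-- GIVEN `Transfer`, `RealKZ` is the summit. [folklore] -/
theorem realKZ_iff_summit_of_transfer (hT : DefinableMoves.Transfer) :
    DefinableMoves.RealKZ ↔ _root_.KontsevichZagierPeriods :=
  ⟨summit_of_transfer_of_realKZ hT, realKZ_of_summit⟩

/-- GIVEN `RealKZ`, `Transfer` is the summit — so `Transfer → S` is EXACTLY as hard as `RealKZ` is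
unavailable: no proof of `Transfer → S` can bypass Conjecture 1 with real intermediates. [folklore] -/
theorem transfer_iff_summit_of_realKZ (hR : DefinableMoves.RealKZ) :
    DefinableMoves.Transfer ↔ _root_.KontsevichZagierPeriods :=
  ⟨fun hT => summit_of_transfer_of_realKZ hT hR, transfer_of_summit⟩

end Summit.KontsevichZagierPeriods.KontsevichZagierPeriods.Cruxes.Transfer.Placement

end
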